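import Literature.MathematicalPhysics.QuantumFieldTheory.Balaban1983to89.MatrixLogLipschitz
import Literature.MathematicalPhysics.QuantumFieldTheory.Balaban1983to89.BlockAveragingEMLAnalyticMean
import Literature.MathematicalPhysics.QuantumFieldTheory.Balaban1983to89.T3UnitLawDensityEML
import Literature.Analysis.Complex.RungeUnits
import Summits.QuantumFields.YangMills.Theorems.UnitScaleTiltMinimiserStabilityRegPrAvgActionDefect
import HarnessLib

/-!
# S2β · `hFlat` road, brick (γ)-lite — THE PRINTED SMALL-LOOP AVERAGE `exp ∘ mean ∘ log` IS LIPSCHITZ IN THE ℓ¹-MEAN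
# WITH A SECOND-ORDER DEFECT: `dist1 (ℰ W′ · (ℰ W)⁻¹) ≤ (1 − ρ)⁻² · |I|⁻¹ Σ_i dist1 (W′_i · W_i⁻¹) ≤ (1 + 4ρ) · (mean)`
# for two `ρ`-small families (`ρ <` the `SU(N)` guard radius `δ_N = min(1∕3, π∕N)`)

Cell `ym3-torus` (rung R3 = continuum `SU(2)` Yang–Mills on the three-torus — NOT d = 4, NOT infinite volume, NOT a mass
gap, NOT Clay).  Width seat «width 8» `ym3-torus-px8` (gen 21), FREE px helper on crux `stmt-QuantumFields-20520`
(`Theses.UnitScaleTilt.FluctuationComparisonRegPrIntL`), count-neutral, DEFINITION-FREE.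

Named by px12 g22 (HFLAT-ROAD-AFTER-6 §4 (γ) ∕ §5, bus 2026-08-31 05:54Z) as the per-level input of the nonabelian
unrolling of the `m`-fold averaged transporter `ū^m` on the road to the depth-uniform flat letter `hFlat` of
✓`…S2BetaGapOrbitOfStrata.uniformFibreGapOrbit_of_strata_of_flat`: the per-level Lipschitz defects `1 + C·θBal(i)` must
MULTIPLY to a depth-free constant along the geometric threshold sequence, which they do iff (i) the constant in front of the
mean is `1 + O(ρ)` and (ii) the right side is the ℓ¹-MEAN over the family — the MEAN edition is what this file adds to the
tree's SUP editions ✓`B13AvgCorrEmlVariation.norm_eml_sub_eml_le` (`‖eml U′ − eml U‖ ≤ ‖U′ − U‖_∞∕(1−ρ)²`) and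
✓`…OneBondFamily.norm_eml_sub_eml_le` (`‖mean‖ + 144 r‖·‖_∞`), both of which lose `|I|` against a mean.

* §1 (any complete normed `ℂ`-algebra): `norm_meanCLM_le_mean_norm` (`‖mean v‖ ≤ |I|⁻¹ Σ ‖v_i‖`),
  `norm_meanCLM_mlog_sub_le_mean` (`≤ (1−ρ)⁻¹ · |I|⁻¹ Σ ‖U′_i − U_i‖`, lit ✓`norm_mlog_sub_mlog_le` termwise),
  ★ `norm_eml_sub_eml_le_mean` (`‖eml U′ − eml U‖ ≤ (1−ρ)⁻² · |I|⁻¹ Σ ‖U′_i − U_i‖`: lit ✓`norm_exp_sub_exp_le` with both means of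
  logarithms in the ball `‖Z‖ ≤ −log(1−ρ)`), the numeric step `inv_one_sub_sq_le`
  (`(1−ρ)⁻² ≤ 1 + 4ρ` on `0 ≤ ρ ≤ 1∕3`) and ★★ `norm_eml_sub_eml_le_mean_lin`.
* §2 (`SU(N)`, operator norm, the tree's `dist1 = ‖· − 1‖`, so `dist1 (A·B⁻¹) = ‖A − B‖`): ★★ `dist1_E_mul_inv_le_mean`
  (`dist1 (E W′ · (E W)⁻¹) ≤ (1−ρ)⁻² · (m+1)⁻¹ Σ_i dist1 (W′_i · W_i⁻¹)` under `dist1 W_i, dist1 W′_i ≤ ρ < δ_N`),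
  ★★ `dist1_E_mul_inv_le_mean_lin` (`≤ (1 + 4ρ)·mean`), the `LoopAverage.avg` spellings over any nonempty finite index type
  (`dist1_avg_mul_inv_le_mean`, `…_lin`), the CENTRED corollaries against a small constant `W̄` (`E_const`,
  `dist1_E_mul_const_inv_le_mean(_lin)`, `dist1_avg_mul_const_inv_le_mean_lin` — px12 g22 (w1)), and §3 the `SU(2)` carrier's `ℰp`
  spellings (guard radius `δ_2 = 1∕3`).

HONEST SCOPE.  Power-series ∕ mean-value bookkeeping for the printed operation (0.4) of [Balaban1987RG1] over the tree's landed
Lipschitz letters; nothing of Bałaban's analysis is asserted or proved; the unrolling of `ū^m`, `hFlat`, TUBE-REG∘, GAP♯∘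
(`stub_uniformFibreGapOrbit`), S2β, crux 20520 and `YM3TorusSU2` are NOT proved; no registered stub is closed by this file; the
Yang–Mills mass gap is NOT proved.
References: T. Bałaban, CMP **109** (1987) 249–301 [Balaban1987RG1] ((0.4)–(0.7) p.253); CMP **98** (1985) 17–51
[Balaban1985Averaging] ((21), (26) pp.21–22).
-/

set_option autoImplicit false

noncomputable section

open NormedSpace
open scoped BigOperators Matrix.Norms.L2Operator

namespace Summit.QuantumFields.YangMills.Theorems.FluctuationComparisonRegPrIntLS2BetaExpMeanLogLipschitz

open Literature.MathematicalPhysics.QuantumFieldTheory.Balaban1983to89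
open Literature.MathematicalPhysics.QuantumFieldTheory.Balaban1983to89.MatrixLog (mlog norm_mlog_le_neg_log exp_mlog)
open Literature.MathematicalPhysics.QuantumFieldTheory.Balaban1983to89.MatrixLogLipschitz (norm_mlog_sub_mlog_le)
open Literature.MathematicalPhysics.QuantumFieldTheory.Balaban1983to89.B7TransferAnalyticMean (meanCLM meanCLM_apply)
open Literature.MathematicalPhysics.QuantumFieldTheory.Balaban1983to89.ExpMeanLog
  (eml eml_eq_exp deltaSU deltaSU_pos expMeanLogSU lt_third_of_lt_deltaSU)
open Literature.MathematicalPhysics.QuantumFieldTheory.Balaban1983to89.BlockAveragingEMLAnalyticMean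
  (eml_eq_exp_meanCLM coe_expMeanLogSU_E_eq_eml)
open Literature.MathematicalPhysics.QuantumFieldTheory.Balaban1983to89.T3UnitLawDensityEML (ℰp)
open Literature.Analysis.Complex (norm_exp_sub_exp_le)
open Summit.QuantumFields.YangMills.Theorems (AvgActionDefect.deltaSU_fin_two)

/-! ## §1 The Banach-algebra level: `exp ∘ mean ∘ log` is Lipschitz in the ℓ¹-mean with constant `(1 − ρ)⁻² = 1 + O(ρ)` -/

section Generic

variable {𝔸 : Type*} [NormedRing 𝔸] [NormedAlgebra ℂ 𝔸] [CompleteSpace 𝔸]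
variable {ι : Type*} [Fintype ι]

omit [CompleteSpace 𝔸] in
/-- `‖|I|⁻¹ Σ_i v_i‖ ≤ |I|⁻¹ Σ_i ‖v_i‖` — the ℓ¹-MEAN bound for the tree's `meanCLM` (its ✓`norm_meanCLM_apply_le` is the sup bound). [folklore] -/
theorem norm_meanCLM_le_mean_norm (v : ι → 𝔸) :
    ‖meanCLM ι 𝔸 v‖ ≤ ((Fintype.card ι : ℝ))⁻¹ * ∑ i, ‖v i‖ := by
  rw [meanCLM_apply, norm_smul, norm_inv, Complex.norm_natCast]
  exact mul_le_mul_of_nonneg_left (norm_sum_le _ _) (inv_nonneg.mpr (Nat.cast_nonneg _))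

/-- **The means of the logarithms of two `ρ`-small families differ by at most `(1 − ρ)⁻¹` times the ℓ¹-MEAN of the member
differences** (lit ✓`norm_mlog_sub_mlog_le` termwise, then `norm_meanCLM_le_mean_norm`). [cite: Balaban1985Averaging, (21) p.21] -/
theorem norm_meanCLM_mlog_sub_le_mean {ρ : ℝ} (hρ1 : ρ < 1) {U U' : ι → 𝔸} (hU : ∀ i, ‖U i - 1‖ ≤ ρ)
    (hU' : ∀ i, ‖U' i - 1‖ ≤ ρ) :
    ‖meanCLM ι 𝔸 (fun j => mlog (U' j)) - meanCLM ι 𝔸 (fun j => mlog (U j))‖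
      ≤ (1 - ρ)⁻¹ * (((Fintype.card ι : ℝ))⁻¹ * ∑ i, ‖U' i - U i‖) := by
  rw [← map_sub]
  refine (norm_meanCLM_le_mean_norm _).trans ?_
  have hc : (0 : ℝ) ≤ ((Fintype.card ι : ℝ))⁻¹ := inv_nonneg.mpr (Nat.cast_nonneg _)
  calc ((Fintype.card ι : ℝ))⁻¹ * ∑ i, ‖((fun j => mlog (U' j)) - fun j => mlog (U j)) i‖
      ≤ ((Fintype.card ι : ℝ))⁻¹ * ∑ i, ‖U' i - U i‖ / (1 - ρ) :=
        mul_le_mul_of_nonneg_left (Finset.sum_le_sum fun i _ => norm_mlog_sub_mlog_le hρ1 (hU' i) (hU i)) hc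
    _ = (1 - ρ)⁻¹ * (((Fintype.card ι : ℝ))⁻¹ * ∑ i, ‖U' i - U i‖) := by
        rw [← Finset.sum_div, div_eq_mul_inv]; ring

variable [NormOneClass 𝔸]

/-- ★ **`eml` IS `(1 − ρ)⁻²`-LIPSCHITZ IN THE ℓ¹-MEAN ON `ρ`-SMALL FAMILIES** (`0 ≤ ρ < 1`): `‖eml U′ − eml U‖ ≤ (1 − ρ)⁻² · |I|⁻¹ Σ_i
‖U′_i − U_i‖` — one factor `(1−ρ)⁻¹` is the Lipschitz constant of `log` on the polydisc, the other is `e^{−log(1−ρ)}`, that of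
`exp` on the ball `‖Z‖ ≤ −log(1−ρ)` containing both means of logarithms (✓`norm_meanCLM_mlog_le`); the MEAN edition of
✓`B13AvgCorrEmlVariation.norm_eml_sub_eml_le`. [cite: Balaban1987RG1, (0.4) p.253] -/
theorem norm_eml_sub_eml_le_mean {ρ : ℝ} (hρ0 : 0 ≤ ρ) (hρ1 : ρ < 1) {U U' : ι → 𝔸} (hU : ∀ i, ‖U i - 1‖ ≤ ρ)
    (hU' : ∀ i, ‖U' i - 1‖ ≤ ρ) :
    ‖eml U' - eml U‖ ≤ ((1 - ρ) ^ 2)⁻¹ * (((Fintype.card ι : ℝ))⁻¹ * ∑ i, ‖U' i - U i‖) := by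
  have h1ρ : 0 < 1 - ρ := by linarith
  rw [eml_eq_exp_meanCLM, eml_eq_exp_meanCLM]
  -- both means of logarithms lie in the ball `‖Z‖ ≤ −log(1 − ρ)` ((26) in its sharp form, termwise; = the tree's
  -- ✓`B13AvgCorrEmlVariation.norm_meanCLM_mlog_le`, re-derived inline to keep this file's imports inside `Literature`)
  have hlog0 : 0 ≤ -Real.log (1 - ρ) := by
    have := Real.log_nonpos (show (0 : ℝ) ≤ 1 - ρ by linarith) (show 1 - ρ ≤ 1 by linarith); linarith
  have hball : ∀ {V : ι → 𝔸}, (∀ i, ‖V i - 1‖ ≤ ρ) → ‖meanCLM ι 𝔸 (fun j => mlog (V j))‖ ≤ -Real.log (1 - ρ) := by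
    intro V hV
    refine (norm_meanCLM_le_mean_norm _).trans ?_
    have hterm : ∀ j, ‖mlog (V j)‖ ≤ -Real.log (1 - ρ) := fun j =>
      (norm_mlog_le_neg_log ((hV j).trans_lt hρ1)).trans
        (neg_le_neg (Real.log_le_log (by linarith) (by linarith [hV j])))
    rcases isEmpty_or_nonempty ι with hι | hι
    · simp [hlog0]
    · have hc : (0 : ℝ) < Fintype.card ι := Nat.cast_pos.mpr Fintype.card_pos
      rw [inv_mul_le_iff₀ hc]
      calc ∑ i, ‖mlog (V i)‖ ≤ ∑ _i : ι, -Real.log (1 - ρ) := Finset.sum_le_sum fun i _ => hterm i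
        _ = Fintype.card ι * -Real.log (1 - ρ) := by rw [Finset.sum_const, Finset.card_univ, nsmul_eq_mul]
  set x := meanCLM ι 𝔸 fun j => mlog (U' j) with hx
  set y := meanCLM ι 𝔸 fun j => mlog (U j) with hy
  have hmax : max ‖x‖ ‖y‖ ≤ -Real.log (1 - ρ) := max_le (hball hU') (hball hU)
  calc ‖exp x - exp y‖ ≤ ‖x - y‖ * Real.exp (max ‖x‖ ‖y‖) := norm_exp_sub_exp_le x y
    _ ≤ ‖x - y‖ * Real.exp (-Real.log (1 - ρ)) :=
        mul_le_mul_of_nonneg_left (Real.exp_le_exp.mpr hmax) (norm_nonneg _)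
    _ = (1 - ρ)⁻¹ * ‖x - y‖ := by
        rw [Real.exp_neg, Real.exp_log h1ρ, mul_comm]
    _ ≤ (1 - ρ)⁻¹ * ((1 - ρ)⁻¹ * (((Fintype.card ι : ℝ))⁻¹ * ∑ i, ‖U' i - U i‖)) := by
        gcongr; exact norm_meanCLM_mlog_sub_le_mean hρ1 hU hU'
    _ = ((1 - ρ) ^ 2)⁻¹ * (((Fintype.card ι : ℝ))⁻¹ * ∑ i, ‖U' i - U i‖) := by
        rw [← mul_assoc, ← mul_inv, sq]

omit [NormOneClass 𝔸] [CompleteSpace 𝔸] [NormedAlgebra ℂ 𝔸] [NormedRing 𝔸] [Fintype ι] in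
/-- **The numeric step**: `(1 − ρ)⁻² ≤ 1 + 4ρ` for `0 ≤ ρ ≤ 1∕3` (`(1 + 4ρ)(1 − ρ)² − 1 = ρ·((1 − 3ρ)(2 − ρ) + ρ²) ≥ 0`). [folklore] -/
theorem inv_one_sub_sq_le {ρ : ℝ} (hρ0 : 0 ≤ ρ) (hρ : ρ ≤ 1 / 3) : ((1 - ρ) ^ 2)⁻¹ ≤ 1 + 4 * ρ := by
  have h1ρ : 0 < (1 - ρ) ^ 2 := by nlinarith
  rw [inv_le_iff_one_le_mul₀ h1ρ]
  have key : (1 + 4 * ρ) * (1 - ρ) ^ 2 - 1 = ρ * ((1 - 3 * ρ) * (2 - ρ) + ρ ^ 2) := by ring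
  nlinarith [mul_nonneg hρ0 (add_nonneg (mul_nonneg (by linarith : (0 : ℝ) ≤ 1 - 3 * ρ) (by linarith : (0 : ℝ) ≤ 2 - ρ))
    (sq_nonneg ρ))]

/-- ★★ **`eml` IS `(1 + 4ρ)`-LIPSCHITZ IN THE ℓ¹-MEAN ON `ρ`-SMALL FAMILIES, `ρ ≤ 1∕3`**: `‖eml U′ − eml U‖ ≤ (1 + 4ρ) · |I|⁻¹ Σ_i
‖U′_i − U_i‖` — the first-order term is the plain mean (constant exactly `1`), all curvature of `exp ∘ mean ∘ log` sits in `4ρ`.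
[cite: Balaban1987RG1, (0.4) p.253] -/
theorem norm_eml_sub_eml_le_mean_lin {ρ : ℝ} (hρ0 : 0 ≤ ρ) (hρ : ρ ≤ 1 / 3) {U U' : ι → 𝔸} (hU : ∀ i, ‖U i - 1‖ ≤ ρ)
    (hU' : ∀ i, ‖U' i - 1‖ ≤ ρ) :
    ‖eml U' - eml U‖ ≤ (1 + 4 * ρ) * (((Fintype.card ι : ℝ))⁻¹ * ∑ i, ‖U' i - U i‖) :=
  (norm_eml_sub_eml_le_mean hρ0 (by linarith) hU hU').trans
    (mul_le_mul_of_nonneg_right (inv_one_sub_sq_le hρ0 hρ)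
      (mul_nonneg (inv_nonneg.mpr (Nat.cast_nonneg _)) (Finset.sum_nonneg fun i _ => norm_nonneg _)))

end Generic

/-! ## §2 The `SU(N)` group currency: `dist1 (E W′ · (E W)⁻¹) ≤ (1 − ρ)⁻² · mean_i dist1 (W′_i · W_i⁻¹)` -/

section SUN

variable {n : Type*} [Fintype n] [DecidableEq n] [Nonempty n]

/-- ★★ **TWO FAMILIES UNDER `expMeanLogSU.E`, ON THE GUARD — MEAN EDITION**: `∀ i, dist1 (W i), dist1 (W′ i) ≤ ρ < δ_N`
(`δ_N = min(1∕3, π∕N)`) gives `dist1 (E W′ · (E W)⁻¹) ≤ (1 − ρ)⁻² · (m+1)⁻¹ Σ_i dist1 (W′_i · W_i⁻¹)` (`E = eml` of the matrices on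
the guard; §1 on `M_N(ℂ)` with the `L²`-operator norm; `dist1 (A·B⁻¹) = ‖A − B‖` on both sides). [cite: Balaban1987RG1, (0.4)-(0.7) p.253] -/
theorem dist1_E_mul_inv_le_mean {m : ℕ} (W W' : Fin (m + 1) → Matrix.specialUnitaryGroup n ℂ)
    {ρ : ℝ} (hρ : ρ < deltaSU n) (hWρ : ∀ i, dist1 (W i) ≤ ρ) (hW'ρ : ∀ i, dist1 (W' i) ≤ ρ) :
    dist1 ((expMeanLogSU (n := n)).E W' * ((expMeanLogSU (n := n)).E W)⁻¹)
      ≤ ((1 - ρ) ^ 2)⁻¹ * ((((m + 1 : ℕ) : ℝ))⁻¹ * ∑ i, dist1 (W' i * (W i)⁻¹)) := by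
  have hρ0 : 0 ≤ ρ := (GaugeGroup.dist1_nonneg _).trans (hWρ 0)
  have hρ1 : ρ < 1 := (lt_third_of_lt_deltaSU hρ).trans (by norm_num)
  have hW : ∀ i, dist1 (W i) < deltaSU n := fun i => (hWρ i).trans_lt hρ
  have hW' : ∀ i, dist1 (W' i) < deltaSU n := fun i => (hW'ρ i).trans_lt hρ
  -- `dist1 (A · B⁻¹) = ‖A − B‖_{op}` on `SU(N)`: `(A B⁻¹ − 1)·B = A − B`, right multiplication by a unitary is an isometry
  have key : ∀ A B : Matrix.specialUnitaryGroup n ℂ, dist1 (A * B⁻¹) = ‖(A : Matrix n n ℂ) - (B : Matrix n n ℂ)‖ := by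
    intro A B
    show ‖((A * B⁻¹ : Matrix.specialUnitaryGroup n ℂ) : Matrix n n ℂ) - 1‖ = _
    have e : ((A * B⁻¹ : Matrix.specialUnitaryGroup n ℂ) : Matrix n n ℂ) - 1 =
        ((A : Matrix n n ℂ) - (B : Matrix n n ℂ)) * ((B⁻¹ : Matrix.specialUnitaryGroup n ℂ) : Matrix n n ℂ) := by
      rw [sub_mul, ← Submonoid.coe_mul, ← Submonoid.coe_mul, mul_inv_cancel, OneMemClass.coe_one]
    rw [e, CStarRing.norm_mul_mem_unitary _ (Matrix.specialUnitaryGroup_le_unitaryGroup (B⁻¹).2)]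
  rw [key, coe_expMeanLogSU_E_eq_eml W' hW', coe_expMeanLogSU_E_eq_eml W hW]
  simp_rw [key]
  have h := norm_eml_sub_eml_le_mean (ι := Fin (m + 1)) (𝔸 := Matrix n n ℂ) hρ0 hρ1
    (U := fun i => (W i : Matrix n n ℂ)) (U' := fun i => (W' i : Matrix n n ℂ)) (fun i => hWρ i) (fun i => hW'ρ i)
  rwa [Fintype.card_fin] at h

/-- ★★ **… LINEAR IN `ρ`**: on the guard (`ρ < δ_N ≤ 1∕3`), `dist1 (E W′ · (E W)⁻¹) ≤ (1 + 4ρ) · (m+1)⁻¹ Σ_i dist1 (W′_i · W_i⁻¹)` —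
per-level defects `1 + 4·θ` multiply to a depth-free constant along a summable threshold sequence. [cite: Balaban1987RG1, (0.4)-(0.7) p.253] -/
theorem dist1_E_mul_inv_le_mean_lin {m : ℕ} (W W' : Fin (m + 1) → Matrix.specialUnitaryGroup n ℂ)
    {ρ : ℝ} (hρ : ρ < deltaSU n) (hWρ : ∀ i, dist1 (W i) ≤ ρ) (hW'ρ : ∀ i, dist1 (W' i) ≤ ρ) :
    dist1 ((expMeanLogSU (n := n)).E W' * ((expMeanLogSU (n := n)).E W)⁻¹)
      ≤ (1 + 4 * ρ) * ((((m + 1 : ℕ) : ℝ))⁻¹ * ∑ i, dist1 (W' i * (W i)⁻¹)) := by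
  have hρ0 : 0 ≤ ρ := (GaugeGroup.dist1_nonneg _).trans (hWρ 0)
  have hρ3 : ρ ≤ 1 / 3 := (lt_third_of_lt_deltaSU hρ).le
  exact (dist1_E_mul_inv_le_mean W W' hρ hWρ hW'ρ).trans (mul_le_mul_of_nonneg_right (inv_one_sub_sq_le hρ0 hρ3)
    (mul_nonneg (inv_nonneg.mpr (Nat.cast_nonneg _)) (Finset.sum_nonneg fun i _ => GaugeGroup.dist1_nonneg _)))

/-- **`E` OF A CONSTANT FAMILY IS THE CONSTANT**, on the guard (`exp (log x) = x`; = the tree's ✓`…HalvingEffGaugeRowGUnitary.eml_const`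
read through ✓`coe_expMeanLogSU_E_eq_eml`). [cite: Balaban1987RG1, (0.4) p.253] -/
theorem E_const {m : ℕ} (Wb : Matrix.specialUnitaryGroup n ℂ) (hWb : dist1 Wb < deltaSU n) :
    (expMeanLogSU (n := n)).E (fun _ : Fin (m + 1) => Wb) = Wb := by
  apply Subtype.ext
  rw [coe_expMeanLogSU_E_eq_eml _ (fun _ => hWb), eml_eq_exp, Finset.sum_const, Finset.card_univ, ← Nat.cast_smul_eq_nsmul ℂ,
    smul_smul, inv_mul_cancel₀ (Nat.cast_ne_zero.2 Fintype.card_ne_zero), one_smul]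
  exact exp_mlog ((lt_third_of_lt_deltaSU hWb).trans (by norm_num))

/-- ★★ **CENTRED COROLLARY (px12 g22 (w1))**: a `ρ`-small family against a `ρ`-small CONSTANT `W̄` (`ρ < δ_N`):
`dist1 (E W · W̄⁻¹) ≤ (1 + 4ρ) · (m+1)⁻¹ Σ_i dist1 (W_i · W̄⁻¹)` — the average is within `(1 + 4ρ)` × the mean distance of the members
from ANY small group element, not only from `1`.  (On re-centring: the loop families of the block average are near `1` by the
small-plaquette guard and the far-from-`1` straight transporter sits OUTSIDE `ℰ` — `avgFun = corr · axialAvg` — so the unrolling of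
`ū^m` meets `ℰ` only on balls about `1`; a common conjugation `u · u⁻¹` of both families is free by (0.6) and `dist1_conj`.)
[cite: Balaban1987RG1, (0.4)-(0.7) p.253] -/
theorem dist1_E_mul_const_inv_le_mean_lin {m : ℕ} (W : Fin (m + 1) → Matrix.specialUnitaryGroup n ℂ)
    (Wb : Matrix.specialUnitaryGroup n ℂ) {ρ : ℝ} (hρ : ρ < deltaSU n) (hWρ : ∀ i, dist1 (W i) ≤ ρ) (hWb : dist1 Wb ≤ ρ) :
    dist1 ((expMeanLogSU (n := n)).E W * Wb⁻¹) ≤ (1 + 4 * ρ) * ((((m + 1 : ℕ) : ℝ))⁻¹ * ∑ i, dist1 (W i * Wb⁻¹)) := by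
  have h := dist1_E_mul_inv_le_mean_lin (fun _ : Fin (m + 1) => Wb) W hρ (fun _ => hWb) hWρ
  rwa [E_const Wb (hWb.trans_lt hρ)] at h

/-- The same with the sharp constant `(1 − ρ)⁻²`. [cite: Balaban1987RG1, (0.4)-(0.7) p.253] -/
theorem dist1_E_mul_const_inv_le_mean {m : ℕ} (W : Fin (m + 1) → Matrix.specialUnitaryGroup n ℂ)
    (Wb : Matrix.specialUnitaryGroup n ℂ) {ρ : ℝ} (hρ : ρ < deltaSU n) (hWρ : ∀ i, dist1 (W i) ≤ ρ) (hWb : dist1 Wb ≤ ρ) :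
    dist1 ((expMeanLogSU (n := n)).E W * Wb⁻¹) ≤ ((1 - ρ) ^ 2)⁻¹ * ((((m + 1 : ℕ) : ℝ))⁻¹ * ∑ i, dist1 (W i * Wb⁻¹)) := by
  have h := dist1_E_mul_inv_le_mean (fun _ : Fin (m + 1) => Wb) W hρ (fun _ => hWb) hWρ
  rwa [E_const Wb (hWb.trans_lt hρ)] at h

variable {ι : Type*} [Fintype ι] [Nonempty ι]

/-- ★★ **Two families over an arbitrary nonempty finite index type** (`LoopAverage.avg` = `E` after the fixed enumeration, the sum
re-indexed by it): `dist1 (avg W′ · (avg W)⁻¹) ≤ (1 − ρ)⁻² · |I|⁻¹ Σ_i dist1 (W′_i · W_i⁻¹)` on the guard. [cite: Balaban1987RG1, (0.4)-(0.7) p.253] -/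
theorem dist1_avg_mul_inv_le_mean (W W' : ι → Matrix.specialUnitaryGroup n ℂ)
    {ρ : ℝ} (hρ : ρ < deltaSU n) (hWρ : ∀ i, dist1 (W i) ≤ ρ) (hW'ρ : ∀ i, dist1 (W' i) ≤ ρ) :
    dist1 ((expMeanLogSU (n := n)).avg W' * ((expMeanLogSU (n := n)).avg W)⁻¹)
      ≤ ((1 - ρ) ^ 2)⁻¹ * (((Fintype.card ι : ℝ))⁻¹ * ∑ i, dist1 (W' i * (W i)⁻¹)) := by
  unfold LoopAverage.avg
  have h := dist1_E_mul_inv_le_mean (W ∘ (LoopAverage.enum ι).symm) (W' ∘ (LoopAverage.enum ι).symm) hρ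
    (fun i => hWρ _) (fun i => hW'ρ _)
  have hsum : ∑ i, dist1 ((W' ∘ (LoopAverage.enum ι).symm) i * ((W ∘ (LoopAverage.enum ι).symm) i)⁻¹)
      = ∑ i, dist1 (W' i * (W i)⁻¹) :=
    Equiv.sum_comp (LoopAverage.enum ι).symm (fun i => dist1 (W' i * (W i)⁻¹))
  have hcard : ((Fintype.card ι - 1 + 1 : ℕ) : ℝ) = (Fintype.card ι : ℝ) := by
    rw [Nat.sub_add_cancel Fintype.card_pos]
  rw [hsum, hcard] at h
  exact h

/-- ★★ … linear in `ρ`: `dist1 (avg W′ · (avg W)⁻¹) ≤ (1 + 4ρ) · |I|⁻¹ Σ_i dist1 (W′_i · W_i⁻¹)` on the guard. [cite: Balaban1987RG1, (0.4)-(0.7) p.253] -/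
theorem dist1_avg_mul_inv_le_mean_lin (W W' : ι → Matrix.specialUnitaryGroup n ℂ)
    {ρ : ℝ} (hρ : ρ < deltaSU n) (hWρ : ∀ i, dist1 (W i) ≤ ρ) (hW'ρ : ∀ i, dist1 (W' i) ≤ ρ) :
    dist1 ((expMeanLogSU (n := n)).avg W' * ((expMeanLogSU (n := n)).avg W)⁻¹)
      ≤ (1 + 4 * ρ) * (((Fintype.card ι : ℝ))⁻¹ * ∑ i, dist1 (W' i * (W i)⁻¹)) := by
  have hρ0 : 0 ≤ ρ := (GaugeGroup.dist1_nonneg _).trans (hWρ (Classical.arbitrary ι))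
  have hρ3 : ρ ≤ 1 / 3 := (lt_third_of_lt_deltaSU hρ).le
  exact (dist1_avg_mul_inv_le_mean W W' hρ hWρ hW'ρ).trans (mul_le_mul_of_nonneg_right (inv_one_sub_sq_le hρ0 hρ3)
    (mul_nonneg (inv_nonneg.mpr (Nat.cast_nonneg _)) (Finset.sum_nonneg fun i _ => GaugeGroup.dist1_nonneg _)))

/-- ★★ centred, over any nonempty finite index type: `dist1 (avg W · W̄⁻¹) ≤ (1 + 4ρ) · |I|⁻¹ Σ_i dist1 (W_i · W̄⁻¹)` on the guard.
[cite: Balaban1987RG1, (0.4)-(0.7) p.253] -/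
theorem dist1_avg_mul_const_inv_le_mean_lin (W : ι → Matrix.specialUnitaryGroup n ℂ) (Wb : Matrix.specialUnitaryGroup n ℂ)
    {ρ : ℝ} (hρ : ρ < deltaSU n) (hWρ : ∀ i, dist1 (W i) ≤ ρ) (hWb : dist1 Wb ≤ ρ) :
    dist1 ((expMeanLogSU (n := n)).avg W * Wb⁻¹) ≤ (1 + 4 * ρ) * (((Fintype.card ι : ℝ))⁻¹ * ∑ i, dist1 (W i * Wb⁻¹)) := by
  have h := dist1_avg_mul_inv_le_mean_lin (fun _ : ι => Wb) W hρ (fun _ => hWb) hWρ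
  have hc : (expMeanLogSU (n := n)).avg (fun _ : ι => Wb) = Wb := by
    unfold LoopAverage.avg
    exact E_const Wb (hWb.trans_lt hρ)
  rwa [hc] at h

end SUN

/-! ## §3 The `SU(2)` carrier's `ℰp` spellings (guard radius `δ_2 = min(1∕3, π∕2) = 1∕3`, ✓`AvgActionDefect.deltaSU_fin_two`) -/

section Carrier

/-- ★★ **`ℰp`-EDITION, `Fin (m+1)`-FAMILIES**: for `dist1 W_i, dist1 W′_i ≤ ρ < 1∕3`,
`dist1 (ℰp.E W′ · (ℰp.E W)⁻¹) ≤ (1 + 4ρ) · (m+1)⁻¹ Σ_i dist1 (W′_i · W_i⁻¹)` — the per-level input of the unrolling of the `m`-fold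
averaged transporter (px12 g22 HFLAT-ROAD §4 (γ)). [cite: Balaban1987RG1, (0.4)-(0.7) p.253] -/
theorem dist1_ℰp_E_mul_inv_le_mean_lin {m : ℕ} (W W' : Fin (m + 1) → Matrix.specialUnitaryGroup (Fin 2) ℂ)
    {ρ : ℝ} (hρ : ρ < 1 / 3) (hWρ : ∀ i, dist1 (W i) ≤ ρ) (hW'ρ : ∀ i, dist1 (W' i) ≤ ρ) :
    dist1 ((ℰp).E W' * ((ℰp).E W)⁻¹) ≤ (1 + 4 * ρ) * ((((m + 1 : ℕ) : ℝ))⁻¹ * ∑ i, dist1 (W' i * (W i)⁻¹)) :=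
  dist1_E_mul_inv_le_mean_lin W W' (hρ.trans_le (AvgActionDefect.deltaSU_fin_two).ge) hWρ hW'ρ

/-- ★★ **`ℰp`-EDITION OVER ANY NONEMPTY FINITE INDEX TYPE** (`ℰp.avg`, e.g. the loop families `Idx P` of the block average):
`dist1 (ℰp.avg W′ · (ℰp.avg W)⁻¹) ≤ (1 + 4ρ) · |I|⁻¹ Σ_i dist1 (W′_i · W_i⁻¹)` for `ρ < 1∕3`. [cite: Balaban1987RG1, (0.4)-(0.7) p.253] -/
theorem dist1_ℰp_avg_mul_inv_le_mean_lin {ι : Type*} [Fintype ι] [Nonempty ι]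
    (W W' : ι → Matrix.specialUnitaryGroup (Fin 2) ℂ)
    {ρ : ℝ} (hρ : ρ < 1 / 3) (hWρ : ∀ i, dist1 (W i) ≤ ρ) (hW'ρ : ∀ i, dist1 (W' i) ≤ ρ) :
    dist1 ((ℰp).avg W' * ((ℰp).avg W)⁻¹) ≤ (1 + 4 * ρ) * (((Fintype.card ι : ℝ))⁻¹ * ∑ i, dist1 (W' i * (W i)⁻¹)) :=
  dist1_avg_mul_inv_le_mean_lin W W' (hρ.trans_le (AvgActionDefect.deltaSU_fin_two).ge) hWρ hW'ρ

/-- The same with the sharp constant `(1 − ρ)⁻²`. [cite: Balaban1987RG1, (0.4)-(0.7) p.253] -/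
theorem dist1_ℰp_avg_mul_inv_le_mean {ι : Type*} [Fintype ι] [Nonempty ι]
    (W W' : ι → Matrix.specialUnitaryGroup (Fin 2) ℂ)
    {ρ : ℝ} (hρ : ρ < 1 / 3) (hWρ : ∀ i, dist1 (W i) ≤ ρ) (hW'ρ : ∀ i, dist1 (W' i) ≤ ρ) :
    dist1 ((ℰp).avg W' * ((ℰp).avg W)⁻¹) ≤ ((1 - ρ) ^ 2)⁻¹ * (((Fintype.card ι : ℝ))⁻¹ * ∑ i, dist1 (W' i * (W i)⁻¹)) :=
  dist1_avg_mul_inv_le_mean W W' (hρ.trans_le (AvgActionDefect.deltaSU_fin_two).ge) hWρ hW'ρ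

/-- ★★ `ℰp`-edition, centred: `dist1 (ℰp.avg W · W̄⁻¹) ≤ (1 + 4ρ) · |I|⁻¹ Σ_i dist1 (W_i · W̄⁻¹)` for `dist1 W_i, dist1 W̄ ≤ ρ < 1∕3`.
[cite: Balaban1987RG1, (0.4)-(0.7) p.253] -/
theorem dist1_ℰp_avg_mul_const_inv_le_mean_lin {ι : Type*} [Fintype ι] [Nonempty ι]
    (W : ι → Matrix.specialUnitaryGroup (Fin 2) ℂ) (Wb : Matrix.specialUnitaryGroup (Fin 2) ℂ)
    {ρ : ℝ} (hρ : ρ < 1 / 3) (hWρ : ∀ i, dist1 (W i) ≤ ρ) (hWb : dist1 Wb ≤ ρ) :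
    dist1 ((ℰp).avg W * Wb⁻¹) ≤ (1 + 4 * ρ) * (((Fintype.card ι : ℝ))⁻¹ * ∑ i, dist1 (W i * Wb⁻¹)) :=
  dist1_avg_mul_const_inv_le_mean_lin W Wb (hρ.trans_le (AvgActionDefect.deltaSU_fin_two).ge) hWρ hWb

end Carrier

end Summit.QuantumFields.YangMills.Theorems.FluctuationComparisonRegPrIntLS2BetaExpMeanLogLipschitz

end
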